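import Summits.Ventures.QEC.Thresholds.CSSFamilyThresholds
import Literature.InformationTheory.QuantumCodes.ToricCodeErasureHalf
import HarnessLib

/-!
# The LOSS threshold of the toric code is EXACTLY `1/2` — Q5 packaging (KERNEL, unconditional)

Venture QEC, `Summits/Ventures/QEC/Thresholds/` (LADDER-QEC rung Q5; qec-type-03 gen 5, cell item 03.LOSSHALF).
HONEST FRAMING: every statement is an UNCONDITIONAL kernel theorem (axioms `propext`, `Classical.choice`,
`Quot.sound`; no `native_decide`, no named fact). This file only INSTANTIATES, in the cell's Q5 CENSUS vocabulary
(the sector families `zErasureFamily` / `xErasureFamily` of `CSSFamilyThresholds.lean`), the Literature theorems of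
`ToricCodeErasureHalf.lean` (which already speak `IsThresholdLowerBound` / `accuracyThreshold` and are cited, not
restated — gate dedup rule):

| statement | theorem | source of the proof |
|---|---|---|
| `y_c ≥ 1/2`: every loss rate `y < 1/2` is below threshold (`P_y[uncorrectable] → 0`) | `ToricCode.erasureThreshold_half` (Literature, cited — not restated) | Kesten's theorem `p_c(ℤ²) = 1/2` + subcritical sharpness, PROVED in the tree (`Kesten1980_expDecay`), through the torus-homology ↔ bond-percolation dictionary (`ToricCodeErasureHalfGeometry/Law.lean`) |
| ★ `y_c = 1/2` EXACTLY (`accuracyThreshold erasureFamily = 1/2`) | `ToricCode.erasure_accuracyThreshold_eq_half` (Literature) | floor above + lit-2's no-cloning ceiling `erasure_threshold_le_half` |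
| `y > 1/2 ⇒ P_y[uncorrectable] → 1` | `ToricCode.tendsto_erasureFamily_one` (Literature) | no-cloning identity `1 ≤ P_y + P_{1-y}` + the floor at `1 - y` |
| both sectors (CENSUS form, this file): `accuracyThreshold (z/xErasureFamily (fun L => toricCode (L+1))) = 1/2` | `toric_z/x_erasure_accuracyThreshold_eq_half`, `toric_x_lossThreshold_half` | lattice self-duality `uncorrectableProb_dual` |
| every CONSISTENT loss-decoder family: EXACTLY `1/2`; NO decoder family above `1/2`; the canonical decoders (this file) | `ToricCode.erasureDecoder_accuracyThreshold_eq_half`, `ToricCode.erasureDecoder_threshold_le_half` (Literature); `lossDecoderThreshold_canonical_eq_half` | Delfosse–Zémor Lemma 1 (`failureProb` vs `uncorrectableProb`) |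

This supersedes the certified INTERVAL `.3712 < y_c ≤ 1/2` of `ToricCodeLossThresholds.lean` /
`ToricCodeThresholdKernelSymmK16.lean` (floors by self-avoiding-walk counting) by the exact printed VALUE `0.5` of
Stace–Barrett–Doherty 2009 — the first exact threshold value among the cell's Q5 rows.

## References

* [StaceBarrettDoherty2009] T. M. Stace, S. D. Barrett, A. C. Doherty, *Thresholds for topological codes in the
  presence of loss*, PRL 102 (2009) 200501, arXiv:0904.3556, p. 1 (abstract: "the maximum tolerable loss rate is 50%"),
  p. 2–3 ("for `p_loss < 0.5` loss recovery almost surely succeeds, whereas for `p_loss > 0.5` loss recovery almost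
  surely fails").
* [KestenCMP1980] H. Kesten, Comm. Math. Phys. 74 (1980) 41–59, Thm. 1, Thm. 2 (1.7).
* [DelfosseZemor2020] N. Delfosse, G. Zémor, PRR 2 (2020) 033042, §2, Lemma 1.
-/

noncomputable section

namespace Summit.Ventures.QEC.Thresholds

open Filter Topology
open Literature.InformationTheory.QuantumCodes
open Literature.InformationTheory.QuantumCodes.ToricCode

/-! ### Census form: both sectors of `fun L => toricCode (L + 1)` -/

/-- The census `Z`-sector erasure family of the toric codes IS the DKLP loss family (definitional).
[cite: StaceBarrettDoherty2009, p. 2 (loss criterion)] -/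
theorem toric_zErasureFamily_eq : zErasureFamily (fun L => toricCode (L + 1)) = erasureFamily := rfl

/-- The census `X`-sector erasure family of the toric codes equals the DKLP loss family (lattice self-duality,
`ToricCode.uncorrectableProb_dual`). [cite: StaceBarrettDoherty2009, p. 2 (losses affect both logical operators alike)] -/
theorem toric_xErasureFamily_eq : xErasureFamily (fun L => toricCode (L + 1)) = erasureFamily := by
  funext L y
  exact uncorrectableProb_dual y

/-- ★ **`Z`-sector loss threshold of the toric codes = `1/2` exactly** (census form).
[cite: StaceBarrettDoherty2009, p. 1 (abstract)] -/
theorem toric_z_erasure_accuracyThreshold_eq_half :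
    accuracyThreshold (zErasureFamily (fun L => toricCode (L + 1))) = 1 / 2 := by
  rw [toric_zErasureFamily_eq]
  exact erasure_accuracyThreshold_eq_half

/-- ★ **`X`-sector loss threshold of the toric codes = `1/2` exactly** (census form).
[cite: StaceBarrettDoherty2009, p. 1 (abstract)] -/
theorem toric_x_erasure_accuracyThreshold_eq_half :
    accuracyThreshold (xErasureFamily (fun L => toricCode (L + 1))) = 1 / 2 := by
  rw [toric_xErasureFamily_eq]
  exact erasure_accuracyThreshold_eq_half

/-- `X`-sector floor in `IsThresholdLowerBound` form. [cite: StaceBarrettDoherty2009, p. 2–3] -/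
theorem toric_x_lossThreshold_half : IsThresholdLowerBound (xErasureFamily (fun L => toricCode (L + 1))) (1 / 2) := by
  rw [toric_xErasureFamily_eq]
  exact erasureThreshold_half

/-- `X`-sector supercritical half (census form): for `1/2 < y ≤ 1` the `X`-uncorrectability probability tends to `1`.
[cite: StaceBarrettDoherty2009, p. 3 (for p_loss > 0.5 loss recovery almost surely fails)] -/
theorem toric_x_loss_tendsto_one {y : ℝ} (hy : 1 / 2 < y) (hy1 : y ≤ 1) :
    Tendsto (fun L => xErasureFamily (fun L => toricCode (L + 1)) L y) atTop (𝓝 1) := by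
  rw [toric_xErasureFamily_eq]
  exact tendsto_erasureFamily_one hy hy1

/-! ### Decoder forms -/

/-- Non-vacuity: the canonical loss decoders (any chain on the lost links with the observed boundary) are consistent,
so their loss accuracy threshold is exactly `1/2`. [cite: DelfosseZemor2020, Lemma 1] -/
theorem lossDecoderThreshold_canonical_eq_half :
    accuracyThreshold (fun L y =>
      (ErasureDecoder.canonical (syn (L + 1))).failureProb (syn (L + 1)) (boundaries (L + 1)) y) = 1 / 2 :=
  erasureDecoder_accuracyThreshold_eq_half (fun L => ErasureDecoder.canonical (syn (L + 1)))
    fun L => canonical_isConsistent_toric (L + 1)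

end Summit.Ventures.QEC.Thresholds
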